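import Summits.SmoothPoincare4.SmoothPoincare4.Theorems.DottedCircleRasmussenDcrGapHelperHandlebodyChartModelHandlesCalculus
import Summits.SmoothPoincare4.SmoothPoincare4.Theorems.DottedCircleRasmussenDcrGapHelperHandlebodyChartModelHandlesRegime

/-!
# Helper `helper_handlebodyChart_modelHandles` (M3: handle structure of the model dotted handlebody `D_k`)
# of line `mk_friends` for crux `DcrGap` — handle charts, part 9: the clauses of one chart
(item stmt-SmoothPoincare4-16128, route route-SmoothPoincare4-DottedCircleRasmussen)

Towards the registered stub `helper_handlebodyChart_modelHandles_data_part1`.  Here the pieces are put together for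
ONE handle chart `h` of hole `j`, given (without definitions, by defining equations) by the profiles `R`, `S` of
`…ModelHandlesProfiles.lean` at `V = |v_j|` (`v_j = c_j - z₀`, `z₀ = -20k i`), the width `b(p₁) = (793 + 95 p₁)/500`,
the planar components `r = R(p₀) + b(p₁) sin(π S(p₀))`, `m = -b(p₁) cos(π S(p₀))`, the scale `N = 110(k + 1)` and
the polar formulas `z(h p) = z₀ + r s (v_j/|v_j|) e(m)`, `w(h p) = (r/N)(p₂ + i p₃)` on the parameter box
`W = {|p₀| < 1.01, |p₁| < 1.01, p₂² + p₃² < 6/5}`: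

* `ModelHandles.chart_static`: `h` is smooth, injective and immersive on `W`; `dist(h p, c) = a(2 - |p₀|)` for
  `|p₀| ≥ 1/2` and `≥ 3a/2` for `|p₀| ≤ 1/2` (`a = 2/15`); equivariance;
* `ModelHandles.chart_mapsTo`: `h(W) ⊆ D_k` (all holes at distance `≥ 27/20`, `|z| ≤ 20(k+1)`, `|w|² ≤ 1/20`);
* `ModelHandles.chart_lifts`: the smooth invariant lifts of `arg(z(h p) - c_l)` with the prescribed end values
  (`arg((z - c_j)\bar v_j) + arg v_j` about the own hole, the ball branch about the others);
* `ModelHandles.charts_disjoint`: charts of distinct holes have disjoint images.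

Registered summary `helper_handlebodyChart_modelHandles_chartStatic`.  No definitions, no named facts,
no `sorry`.  References: R. Kirby, *The Topology of 4-Manifolds*, LNM 1374 (1989), Ch. I §2 [Kirby1989].
-/

-- the prescribed namespace `Summit.<P>.<Sub>.…` duplicates `SmoothPoincare4` (P = Sub)
set_option linter.dupNamespace false
set_option linter.style.longLine false
noncomputable section

open scoped Manifold ContDiff Topology ComplexConjugate
open Function Set Metric Filter
open Literature.Topology.FourManifolds Literature.Topology.FourManifolds.MMSW
open Literature.AlgebraicTopology.Homotopy.HopfFibration

namespace Summit.SmoothPoincare4.SmoothPoincare4.Theorems.DcrGap.MkFriends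

namespace ModelHandles

/-! ## The static clauses -/

/-- **The static clauses of one handle chart**: `h` is smooth, injective and immersive on `W`, conical about
`c = (z₀, 0)` with `dist(h p, c) = a(2 - |p₀|)` for `|p₀| ≥ 1/2` and `≥ 3a/2` for `|p₀| ≤ 1/2` (`a = 2/15`), and
equivariant under the rotations of the `(p₂, p₃)`-plane. [folklore] -/
theorem chart_static {k : ℕ} {j : Fin k} {R S b : ℝ → ℝ} {fr fm : ℝ → ℝ → ℝ} {v : ℂ} {N : ℝ} {e : ℝ → ℂ}
    {h : EuclideanSpace ℝ (Fin 4) → EuclideanSpace ℝ (Fin 4)} {W : Set (EuclideanSpace ℝ (Fin 4))}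
    (hv : v = holeCentre k j - Complex.mk 0 (-(20 * (k : ℝ))))
    (hRs : ContDiff ℝ ∞ R) (hSs : ContDiff ℝ ∞ S) (hReven : ∀ t, R (-t) = R t) (hSsymm : ∀ t, S (-t) = 1 - S t)
    (hRout : ∀ t, 1 / 2 ≤ |t| → R t = 2 / 15 * (2 - |t|))
    (hRbend : ∀ t, |t| ≤ 1 / 5 → ‖v‖ - 1 / 250 ≤ R t ∧ R t ≤ ‖v‖)
    (hRbounds : ∀ t, -2 ≤ t → t ≤ 0 → 2 / 15 * (2 + t) ≤ R t ∧ R t ≤ ‖v‖) (hRmono : StrictMonoOn R (Icc (-2) 0))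
    (hS0 : ∀ t, t ≤ -1 / 5 → S t = 0) (hS1 : ∀ t, 1 / 5 ≤ t → S t = 1) (hSmono : StrictMonoOn S (Icc (-1 / 5) (1 / 5)))
    (hS01 : ∀ t, 0 ≤ S t ∧ S t ≤ 1)
    (hjac : ∀ t b, -2 < t → t < 2 → 0 < b → ∃ R' S' : ℝ, HasDerivAt R R' t ∧ HasDerivAt S S' t ∧
      0 < R' * Real.cos (Real.pi * S t) + b * Real.pi * S')
    (hb : b = fun p => (793 + 95 * p) / 500) (hN : N = 110 * ((k : ℝ) + 1))
    (he : ∀ m, e m = (((‖v‖ : ℝ) : ℂ) + (m : ℂ) * Complex.I) * (((Real.sqrt (‖v‖ ^ 2 + m ^ 2))⁻¹ : ℝ) : ℂ))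
    (hfr : fr = fun t p => R t + b p * Real.sin (Real.pi * S t)) (hfm : fm = fun t p => -(b p) * Real.cos (Real.pi * S t))
    (hz : ∀ p, zC (h p) = Complex.mk 0 (-(20 * (k : ℝ))) +
      ((fr (p 0) (p 1) * Real.sqrt (1 - ((p 2) ^ 2 + (p 3) ^ 2) / N ^ 2) : ℝ) : ℂ) * (v / ((‖v‖ : ℝ) : ℂ)) * e (fm (p 0) (p 1)))
    (hw : ∀ p, wC (h p) = ((fr (p 0) (p 1) / N : ℝ) : ℂ) * ((p 2 : ℂ) + (p 3 : ℂ) * Complex.I))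
    (hWdef : W = {p : EuclideanSpace ℝ (Fin 4) | |p 0| < 101 / 100 ∧ |p 1| < 101 / 100 ∧ (p 2) ^ 2 + (p 3) ^ 2 < 6 / 5}) :
    ContDiffOn ℝ ∞ h W ∧ InjOn h W ∧ (∀ p ∈ W, Injective (fderiv ℝ h p)) ∧
    (∀ p ∈ W, dist (h p) (ofZW (Complex.mk 0 (-(20 * (k : ℝ)))) 0) = fr (p 0) (p 1)) ∧
    (∀ p ∈ W, 1 / 2 ≤ |p 0| → dist (h p) (ofZW (Complex.mk 0 (-(20 * (k : ℝ)))) 0) = 2 / 15 * (2 - |p 0|)) ∧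
    (∀ p ∈ W, |p 0| ≤ 1 / 2 → 3 * (2 / 15) / 2 ≤ dist (h p) (ofZW (Complex.mk 0 (-(20 * (k : ℝ)))) 0)) ∧
    (∀ (β : ℝ) p, h (!₂[p 0, p 1, Real.cos β * p 2 - Real.sin β * p 3, Real.sin β * p 2 + Real.cos β * p 3]) =
      fibreRot (fun _ => Complex.exp ((β : ℂ) * Complex.I)) (h p)) := by
  obtain ⟨-, -, hk, -, -, h20, h416, hv0, hVpos⟩ := holeDir_props j hv
  obtain ⟨he1, -, here, hratio, hes, heinj⟩ := dir_props hVpos e he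
  have hd : ‖v / ((‖v‖ : ℝ) : ℂ)‖ = 1 := by
    rw [norm_div, Complex.norm_real, Real.norm_eq_abs, abs_of_pos hVpos, div_self hVpos.ne']
  have hWo : IsOpen W := (box_props hWdef).1
  have hreg : ∀ p ∈ W, _ := fun p hp =>
    chart_regime hv hReven hRout hRbend hRbounds hRmono hS0 hS1 hS01 hb hN hfr hfm hWdef hp
  have hNpos : 0 < N := by rw [hN]; positivity
  have hpos : ∀ p ∈ W, 0 < fr (p 0) (p 1) := fun p hp => (hreg p hp).2.2.1
  have hWN : ∀ p ∈ W, (p 2) ^ 2 + (p 3) ^ 2 < N ^ 2 := fun p hp => (hreg p hp).2.2.2.2.2.1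
  -- smoothness of the planar components
  have hbs : ContDiff ℝ ∞ b := by rw [hb]; fun_prop
  obtain ⟨hfrs, hfms⟩ := planar_contDiff hRs hSs hbs
  have hfrs' : ContDiffOn ℝ ∞ (fun p : EuclideanSpace ℝ (Fin 4) => fr (p 0) (p 1)) W := by
    rw [hfr]; exact hfrs.contDiffOn
  have hfms' : ContDiffOn ℝ ∞ (fun p : EuclideanSpace ℝ (Fin 4) => fm (p 0) (p 1)) W := by
    rw [hfm]; exact hfms.contDiffOn
  have hsmooth : ContDiffOn ℝ ∞ h W := chart_contDiffOn hes hNpos hz hw hfrs' hfms' hWN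
  have hdist : ∀ p ∈ W, dist (h p) (ofZW (Complex.mk 0 (-(20 * (k : ℝ)))) 0) = fr (p 0) (p 1) := fun p hp => by
    rw [dist_eq_norm]; exact chart_dist hd he1 hNpos hz hw (hpos p hp).le (hWN p hp).le
  refine ⟨hsmooth, ?_, fun p hp => ?_, hdist, fun p hp hh => ?_, fun p hp hh => ?_, fun β p => chart_equivariant hz hw β p⟩
  · -- injectivity
    refine chart_injOn hd he1 heinj hNpos hz hw (fun p hp q hq hr hm => ?_) hpos hWN
    rw [hWdef] at hp hq
    have hbm : StrictMono b := by
      rw [hb]; intro x y hxy; simp only; linarith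
    have hbp : ∀ x : ℝ, -2 < x → 0 < b x := fun x hx => by rw [hb]; simp only; linarith
    have hp0 := abs_lt.1 hp.1
    have hp1 := abs_lt.1 hp.2.1
    have hq0 := abs_lt.1 hq.1
    have hq1 := abs_lt.1 hq.2.1
    rw [hfr] at hr
    rw [hfm] at hm
    simp only at hr hm
    have hm' : b (p 1) * Real.cos (Real.pi * S (p 0)) = b (q 1) * Real.cos (Real.pi * S (q 0)) := by linarith
    exact tube_injective hReven hRmono hS0 hSsymm hSmono hS01 hbm hbp ⟨by linarith, by linarith⟩
      ⟨by linarith, by linarith⟩ ⟨by linarith, by linarith⟩ ⟨by linarith, by linarith⟩ hr hm'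
  · -- immersivity
    refine chart_fderiv_injective hd he1 here hratio hes hNpos hWo hz hw hfrs' hfms' hpos hWN hp fun u h1 h2 => ?_
    have hp' := hp
    rw [hWdef] at hp'
    have hp0 := abs_lt.1 hp'.1
    obtain ⟨hb1, -⟩ := hreg p hp
    obtain ⟨R', S', hR', hS', hD⟩ := hjac (p 0) (b (p 1)) (by linarith) (by linarith) (by linarith)
    have hb' : HasDerivAt b (95 / 500) (p 1) := by
      rw [hb]
      have := ((hasDerivAt_id (p 1)).const_mul (95 : ℝ)).const_add (793 : ℝ) |>.div_const (500 : ℝ)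
      exact this.congr_deriv (by ring)
    rw [hfr] at h1
    rw [hfm] at h2
    exact planar_kernel hR' hS' hb' hD (by norm_num) u h1 h2
  · rw [hdist p hp]; exact (hreg p hp).2.2.2.2.2.2.2.2.2.1 hh
  · rw [hdist p hp]; have := (hreg p hp).2.2.2.2.2.2.2.2.2.2.1 hh; linarith

/-! ## The image lies in the model handlebody -/

/-- **The chart maps the box into `D_k`**: every hole is at distance `≥ 27/20` from `z(h p)` (the own hole by the
planar inequalities, the others by the separation of the directions), `|z(h p)| ≤ 20(k + 1)` and
`|w(h p)|² ≤ 1/20`. [folklore] -/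
theorem chart_mapsTo {k : ℕ} {j : Fin k} {R S b : ℝ → ℝ} {fr fm : ℝ → ℝ → ℝ} {v : ℂ} {N : ℝ} {e : ℝ → ℂ}
    {h : EuclideanSpace ℝ (Fin 4) → EuclideanSpace ℝ (Fin 4)} {W : Set (EuclideanSpace ℝ (Fin 4))}
    (hv : v = holeCentre k j - Complex.mk 0 (-(20 * (k : ℝ))))
    (hReven : ∀ t, R (-t) = R t) (hRout : ∀ t, 1 / 2 ≤ |t| → R t = 2 / 15 * (2 - |t|))
    (hRbend : ∀ t, |t| ≤ 1 / 5 → ‖v‖ - 1 / 250 ≤ R t ∧ R t ≤ ‖v‖)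
    (hRbounds : ∀ t, -2 ≤ t → t ≤ 0 → 2 / 15 * (2 + t) ≤ R t ∧ R t ≤ ‖v‖) (hRmono : StrictMonoOn R (Icc (-2) 0))
    (hS0 : ∀ t, t ≤ -1 / 5 → S t = 0) (hS1 : ∀ t, 1 / 5 ≤ t → S t = 1) (hS01 : ∀ t, 0 ≤ S t ∧ S t ≤ 1)
    (hb : b = fun p => (793 + 95 * p) / 500) (hN : N = 110 * ((k : ℝ) + 1))
    (he : ∀ m, e m = (((‖v‖ : ℝ) : ℂ) + (m : ℂ) * Complex.I) * (((Real.sqrt (‖v‖ ^ 2 + m ^ 2))⁻¹ : ℝ) : ℂ))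
    (hfr : fr = fun t p => R t + b p * Real.sin (Real.pi * S t)) (hfm : fm = fun t p => -(b p) * Real.cos (Real.pi * S t))
    (hz : ∀ p, zC (h p) = Complex.mk 0 (-(20 * (k : ℝ))) +
      ((fr (p 0) (p 1) * Real.sqrt (1 - ((p 2) ^ 2 + (p 3) ^ 2) / N ^ 2) : ℝ) : ℂ) * (v / ((‖v‖ : ℝ) : ℂ)) * e (fm (p 0) (p 1)))
    (hw : ∀ p, wC (h p) = ((fr (p 0) (p 1) / N : ℝ) : ℂ) * ((p 2 : ℂ) + (p 3 : ℂ) * Complex.I))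
    (hWdef : W = {p : EuclideanSpace ℝ (Fin 4) | |p 0| < 101 / 100 ∧ |p 1| < 101 / 100 ∧ (p 2) ^ 2 + (p 3) ^ 2 < 6 / 5}) :
    MapsTo h W (modelHandlebody k) := by
  obtain ⟨-, -, hk, -, -, h20, h416, hv0, hVpos⟩ := holeDir_props j hv
  intro p hp
  obtain ⟨-, hb2, hrpos, hrle, -, -, -, -, -, -⟩ := chart_regime hv hReven hRout hRbend hRbounds hRmono hS0 hS1 hS01 hb hN hfr hfm hWdef hp
  obtain ⟨r', m, σ, ρ, μ, -, -, -, -, -, -, -, -, -, -, -, hρpos, hρle, -, hμV, -, -, -, -, -, e5, hdist, -⟩ :=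
    chart_point hv hReven hRout hRbend hRbounds hRmono hS0 hS1 hS01 hb hN he hfr hfm hz hWdef hp
  have hfar : ∀ l : Fin k, 27 / 20 ≤ ‖zC (h p) - holeCentre k l‖ := by
    intro l
    by_cases hlj : j = l
    · subst hlj
      exact (pow_le_pow_iff_left₀ (by norm_num) (norm_nonneg _) two_ne_zero).1 hdist
    · exact (tubePoint_otherHole hlj hv rfl hρpos hρle hμV _ e5).1
  have hnorm : ‖zC (h p)‖ ≤ 40 * ((k : ℝ) + 1) / 2 := tubePoint_norm_le j hv hρpos hρle hμV _ e5
  have hwn : ‖wC (h p)‖ ^ 2 ≤ 1 / 20 := by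
    rw [hWdef] at hp
    have hV204 : ‖v‖ ≤ 204 / 10 * k := by
      refine (pow_le_pow_iff_left₀ hVpos.le (by positivity) two_ne_zero).1 ?_
      have := sq_nonneg (k : ℝ); rw [mul_pow]; linarith
    have hr22 : fr (p 0) (p 1) ≤ 204 / 10 * ((k : ℝ) + 1) := by linarith
    have hNpos : 0 < N := by rw [hN]; positivity
    rw [hw, norm_mul, Complex.norm_real, Real.norm_eq_abs, abs_of_pos (div_pos hrpos hNpos), Complex.norm_add_mul_I,
      mul_pow, Real.sq_sqrt (by positivity), div_pow, hN]
    have h1 : fr (p 0) (p 1) ^ 2 ≤ (204 / 10 * ((k : ℝ) + 1)) ^ 2 := pow_le_pow_left₀ hrpos.le hr22 2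
    rw [div_mul_eq_mul_div, div_le_iff₀ (by positivity)]
    have h2 := mul_le_mul h1 hp.2.2.le (by positivity) (by positivity)
    nlinarith [h2]
  have := (mem_modelHandlebody_of_far k hnorm hfar hwn).1
  rwa [ofZW_zC_wC] at this

/-! ## The lifts of the angles about the holes -/

/-- Rotating the `(p₂, p₃)`-plane does not change `z(h p)`. [folklore] -/
theorem chart_zC_rot {k : ℕ} {fr fm : ℝ → ℝ → ℝ} {v : ℂ} {N : ℝ} {e : ℝ → ℂ}
    {h : EuclideanSpace ℝ (Fin 4) → EuclideanSpace ℝ (Fin 4)}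
    (hz : ∀ p, zC (h p) = Complex.mk 0 (-(20 * (k : ℝ))) +
      ((fr (p 0) (p 1) * Real.sqrt (1 - ((p 2) ^ 2 + (p 3) ^ 2) / N ^ 2) : ℝ) : ℂ) * (v / ((‖v‖ : ℝ) : ℂ)) * e (fm (p 0) (p 1)))
    (β : ℝ) (p : EuclideanSpace ℝ (Fin 4)) :
    zC (h (!₂[p 0, p 1, Real.cos β * p 2 - Real.sin β * p 3, Real.sin β * p 2 + Real.cos β * p 3])) = zC (h p) := by
  rw [hz, hz]
  have hrot : (Real.cos β * p 2 - Real.sin β * p 3) ^ 2 + (Real.sin β * p 2 + Real.cos β * p 3) ^ 2 =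
      (p 2) ^ 2 + (p 3) ^ 2 := by nlinarith [Real.cos_sq_add_sin_sq β]
  simp [hrot]

/-- **The lifts of `arg(z(h p) - c_l)` along the chart**: smooth on `W`, exponentiating to the unit vector of
`z - c_l`, invariant under the rotations of the `(p₂, p₃)`-plane, and with the prescribed end values — about the
own hole the lift `arg((z - c_j)\bar v_j) + arg v_j` (the cut points from `c_j` towards `z₀`, between the legs),
about the other holes the ball branch (its cut never meets the tube). [folklore] -/
theorem chart_lifts {k : ℕ} {j : Fin k} {R S b : ℝ → ℝ} {fr fm : ℝ → ℝ → ℝ} {v : ℂ} {N : ℝ} {e : ℝ → ℂ}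
    {h : EuclideanSpace ℝ (Fin 4) → EuclideanSpace ℝ (Fin 4)} {W : Set (EuclideanSpace ℝ (Fin 4))}
    (hv : v = holeCentre k j - Complex.mk 0 (-(20 * (k : ℝ))))
    (hReven : ∀ t, R (-t) = R t) (hRout : ∀ t, 1 / 2 ≤ |t| → R t = 2 / 15 * (2 - |t|))
    (hRbend : ∀ t, |t| ≤ 1 / 5 → ‖v‖ - 1 / 250 ≤ R t ∧ R t ≤ ‖v‖)
    (hRbounds : ∀ t, -2 ≤ t → t ≤ 0 → 2 / 15 * (2 + t) ≤ R t ∧ R t ≤ ‖v‖) (hRmono : StrictMonoOn R (Icc (-2) 0))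
    (hS0 : ∀ t, t ≤ -1 / 5 → S t = 0) (hS1 : ∀ t, 1 / 5 ≤ t → S t = 1) (hS01 : ∀ t, 0 ≤ S t ∧ S t ≤ 1)
    (hb : b = fun p => (793 + 95 * p) / 500) (hN : N = 110 * ((k : ℝ) + 1))
    (he : ∀ m, e m = (((‖v‖ : ℝ) : ℂ) + (m : ℂ) * Complex.I) * (((Real.sqrt (‖v‖ ^ 2 + m ^ 2))⁻¹ : ℝ) : ℂ))
    (hfr : fr = fun t p => R t + b p * Real.sin (Real.pi * S t)) (hfm : fm = fun t p => -(b p) * Real.cos (Real.pi * S t))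
    (hz : ∀ p, zC (h p) = Complex.mk 0 (-(20 * (k : ℝ))) +
      ((fr (p 0) (p 1) * Real.sqrt (1 - ((p 2) ^ 2 + (p 3) ^ 2) / N ^ 2) : ℝ) : ℂ) * (v / ((‖v‖ : ℝ) : ℂ)) * e (fm (p 0) (p 1)))
    (hWdef : W = {p : EuclideanSpace ℝ (Fin 4) | |p 0| < 101 / 100 ∧ |p 1| < 101 / 100 ∧ (p 2) ^ 2 + (p 3) ^ 2 < 6 / 5})
    (hZs : ContDiffOn ℝ ∞ (fun p => zC (h p)) W) (l : Fin k) :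
    ∃ Λ : EuclideanSpace ℝ (Fin 4) → ℝ, ContDiffOn ℝ ∞ Λ W ∧
      (∀ p ∈ W, Complex.exp ((Λ p : ℂ) * Complex.I) = (zC (h p) - holeCentre k l) / (((‖zC (h p) - holeCentre k l‖ : ℝ)) : ℂ)) ∧
      (∀ (β : ℝ), ∀ p ∈ W, !₂[p 0, p 1, Real.cos β * p 2 - Real.sin β * p 3, Real.sin β * p 2 + Real.cos β * p 3] ∈ W →
        Λ (!₂[p 0, p 1, Real.cos β * p 2 - Real.sin β * p 3, Real.sin β * p 2 + Real.cos β * p 3]) = Λ p) ∧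
      (∀ p ∈ W, 1 / 2 ≤ |p 0| → Λ p = Complex.arg ((zC (h p) - holeCentre k l) * conj (Complex.mk 0 (-(20 * (k : ℝ))) - holeCentre k l)) +
        Complex.arg (Complex.mk 0 (-(20 * (k : ℝ))) - holeCentre k l) + (if j = l ∧ 0 < p 0 then 2 * Real.pi else 0)) := by
  obtain ⟨-, hvim, hk, -, -, h20, h416, hv0, hVpos⟩ := holeDir_props j hv
  have hpt := fun p (hp : p ∈ W) => chart_point hv hReven hRout hRbend hRbounds hRmono hS0 hS1 hS01 hb hN he hfr hfm hz hWdef hp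
  by_cases hlj : j = l
  · subst hlj
    -- the own hole: `Λ = arg((z - c_j) \bar v) + arg v`
    have hslit : ∀ p ∈ W, (zC (h p) - holeCentre k j) * conj v ∈ Complex.slitPlane := by
      intro p hp
      obtain ⟨r', m, σ, ρ, μ, -, hσ, -, hσpos, -, -, -, hr'pos, -, -, hρ, -, -, -, -, -, -, -, e3, e4, -, -, hgeo⟩ := hpt p hp
      rw [Complex.mem_slitPlane_iff, e3, e4]
      have hbp : 0 < b (p 1) := by
        rw [hb]; rw [hWdef] at hp; have := abs_lt.1 hp.2.1; show 0 < (793 + 95 * p 1) / 500; linarith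
      by_cases hm0 : m = 0
      · left
        have hr' : ‖v‖ < r' := by
          rcases hgeo with ⟨hm2, -, -, -⟩ | ⟨-, s, c, -, -, -, -, -, hmr⟩
          · exfalso; rw [hm0] at hm2; nlinarith
          · exact hmr hm0
        have hσV : σ = ‖v‖ := by rw [hσ, hm0]; simp [Real.sqrt_sq hVpos.le]
        have : 1 < ρ := by rw [hρ, hσV, lt_div_iff₀ hVpos]; linarith
        exact mul_pos (pow_pos hVpos 2) (by linarith)
      · right
        exact mul_ne_zero hVpos.ne' (div_ne_zero (mul_ne_zero hr'pos.ne' hm0) hσpos.ne')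
    obtain ⟨hΛs, hΛexp⟩ := lift_props (e := holeCentre k j) hZs hv0 hslit
    refine ⟨fun p => Complex.arg ((zC (h p) - holeCentre k j) * conj v) + Complex.arg v, hΛs, hΛexp,
      fun β p _ _ => by simp only [chart_zC_rot hz], fun p hp hhalf => ?_⟩
    obtain ⟨r', m, σ, ρ, μ, -, -, -, hσpos, -, -, -, hr'pos, -, -, -, -, -, -, -, -, -, -, -, e4, -, -, hgeo⟩ := hpt p hp
    have e0 : Complex.mk 0 (-(20 * (k : ℝ))) - holeCentre k j = -v := by rw [hv]; ring
    simp only [e0, map_neg, mul_neg, true_and]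
    -- the end-value identity (legs only: `|p₀| ≥ 1/2`)
    obtain ⟨hm2, -, -, hsign⟩ | ⟨h5, -⟩ := hgeo
    · have hbp : 0 < b (p 1) := by
        rw [hb]; rw [hWdef] at hp; have := abs_lt.1 hp.2.1; show 0 < (793 + 95 * p 1) / 500; linarith
      have hm0 : m ≠ 0 := by intro h0; rw [h0] at hm2; nlinarith
      have hwim : ((zC (h p) - holeCentre k j) * conj v).im ≠ 0 := by
        rw [e4]; exact mul_ne_zero hVpos.ne' (div_ne_zero (mul_ne_zero hr'pos.ne' hm0) hσpos.ne')
      rw [arg_end_value (by rw [hvim]; positivity) hwim]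
      congr 1
      have hp0 : p 0 ≠ 0 := by intro h0; rw [h0, abs_zero] at hhalf; norm_num at hhalf
      have hiff : 0 < ((zC (h p) - holeCentre k j) * conj v).im ↔ 0 < p 0 := by
        rw [e4]
        constructor
        · intro hpos
          by_contra hneg; push Not at hneg
          have h1 := hsign.2 (lt_of_le_of_ne hneg hp0)
          have h2 : r' * m / σ < 0 := div_neg_of_neg_of_pos (mul_neg_of_pos_of_neg hr'pos h1) hσpos
          nlinarith
        · intro hpos
          have hm' : 0 < m := by
            rcases lt_or_gt_of_ne hm0 with hlt | hgt
            · exact absurd (hsign.1 hlt) (by linarith)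
            · exact hgt
          exact mul_pos hVpos (div_pos (mul_pos hr'pos hm') hσpos)
      by_cases hq : 0 < p 0
      · rw [if_pos (hiff.2 hq), if_pos hq]
      · rw [if_neg (fun h' => hq (hiff.1 h')), if_neg hq]
    · exfalso; linarith
  · -- another hole: the ball branch
    have hD : Complex.mk 0 (-(20 * (k : ℝ))) - holeCentre k l ≠ 0 := by
      obtain ⟨-, -, -, -, -, -, -, hv0', -⟩ := holeDir_props l (v := holeCentre k l - Complex.mk 0 (-(20 * (k : ℝ)))) rfl
      intro h0; apply hv0'; linear_combination -h0
    have hslit : ∀ p ∈ W, (zC (h p) - holeCentre k l) * conj (Complex.mk 0 (-(20 * (k : ℝ))) - holeCentre k l) ∈ Complex.slitPlane := by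
      intro p hp
      obtain ⟨r', m, σ, ρ, μ, -, -, -, -, -, -, -, -, -, -, -, hρpos, hρle, -, hμV, -, -, -, -, -, e5, -, -⟩ := hpt p hp
      rw [Complex.mem_slitPlane_iff]
      exact Or.inr (tubePoint_otherHole hlj hv rfl hρpos hρle hμV _ e5).2
    obtain ⟨hΛs, hΛexp⟩ := lift_props hZs hD hslit
    refine ⟨fun p => Complex.arg ((zC (h p) - holeCentre k l) * conj (Complex.mk 0 (-(20 * (k : ℝ))) - holeCentre k l)) +
      Complex.arg (Complex.mk 0 (-(20 * (k : ℝ))) - holeCentre k l), hΛs, hΛexp,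
      fun β p _ _ => by simp only [chart_zC_rot hz], fun p _ _ => ?_⟩
    rw [if_neg (fun h' => hlj h'.1), add_zero]

/-! ## Distinct charts are disjoint -/

/-- **Charts of distinct holes have disjoint images**: their planar points lie in disjoint cones from `z₀`
(`ModelHandles.tubePoints_ne`). [folklore] -/
theorem charts_disjoint {k : ℕ} {j j' : Fin k} (hjj : j ≠ j') {R S R₂ S₂ b : ℝ → ℝ} {fr fm fr₂ fm₂ : ℝ → ℝ → ℝ} {v v₂ : ℂ}
    {N : ℝ} {e e₂ : ℝ → ℂ} {h h₂ : EuclideanSpace ℝ (Fin 4) → EuclideanSpace ℝ (Fin 4)} {W : Set (EuclideanSpace ℝ (Fin 4))}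
    (hv : v = holeCentre k j - Complex.mk 0 (-(20 * (k : ℝ)))) (hv₂ : v₂ = holeCentre k j' - Complex.mk 0 (-(20 * (k : ℝ))))
    (hReven : ∀ t, R (-t) = R t) (hRout : ∀ t, 1 / 2 ≤ |t| → R t = 2 / 15 * (2 - |t|))
    (hRbend : ∀ t, |t| ≤ 1 / 5 → ‖v‖ - 1 / 250 ≤ R t ∧ R t ≤ ‖v‖)
    (hRbounds : ∀ t, -2 ≤ t → t ≤ 0 → 2 / 15 * (2 + t) ≤ R t ∧ R t ≤ ‖v‖) (hRmono : StrictMonoOn R (Icc (-2) 0))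
    (hS0 : ∀ t, t ≤ -1 / 5 → S t = 0) (hS1 : ∀ t, 1 / 5 ≤ t → S t = 1) (hS01 : ∀ t, 0 ≤ S t ∧ S t ≤ 1)
    (hReven₂ : ∀ t, R₂ (-t) = R₂ t) (hRout₂ : ∀ t, 1 / 2 ≤ |t| → R₂ t = 2 / 15 * (2 - |t|))
    (hRbend₂ : ∀ t, |t| ≤ 1 / 5 → ‖v₂‖ - 1 / 250 ≤ R₂ t ∧ R₂ t ≤ ‖v₂‖)
    (hRbounds₂ : ∀ t, -2 ≤ t → t ≤ 0 → 2 / 15 * (2 + t) ≤ R₂ t ∧ R₂ t ≤ ‖v₂‖) (hRmono₂ : StrictMonoOn R₂ (Icc (-2) 0))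
    (hS0₂ : ∀ t, t ≤ -1 / 5 → S₂ t = 0) (hS1₂ : ∀ t, 1 / 5 ≤ t → S₂ t = 1) (hS01₂ : ∀ t, 0 ≤ S₂ t ∧ S₂ t ≤ 1)
    (hb : b = fun p => (793 + 95 * p) / 500) (hN : N = 110 * ((k : ℝ) + 1))
    (he : ∀ m, e m = (((‖v‖ : ℝ) : ℂ) + (m : ℂ) * Complex.I) * (((Real.sqrt (‖v‖ ^ 2 + m ^ 2))⁻¹ : ℝ) : ℂ))
    (he₂ : ∀ m, e₂ m = (((‖v₂‖ : ℝ) : ℂ) + (m : ℂ) * Complex.I) * (((Real.sqrt (‖v₂‖ ^ 2 + m ^ 2))⁻¹ : ℝ) : ℂ))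
    (hfr : fr = fun t p => R t + b p * Real.sin (Real.pi * S t)) (hfm : fm = fun t p => -(b p) * Real.cos (Real.pi * S t))
    (hfr₂ : fr₂ = fun t p => R₂ t + b p * Real.sin (Real.pi * S₂ t)) (hfm₂ : fm₂ = fun t p => -(b p) * Real.cos (Real.pi * S₂ t))
    (hz : ∀ p, zC (h p) = Complex.mk 0 (-(20 * (k : ℝ))) +
      ((fr (p 0) (p 1) * Real.sqrt (1 - ((p 2) ^ 2 + (p 3) ^ 2) / N ^ 2) : ℝ) : ℂ) * (v / ((‖v‖ : ℝ) : ℂ)) * e (fm (p 0) (p 1)))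
    (hz₂ : ∀ p, zC (h₂ p) = Complex.mk 0 (-(20 * (k : ℝ))) +
      ((fr₂ (p 0) (p 1) * Real.sqrt (1 - ((p 2) ^ 2 + (p 3) ^ 2) / N ^ 2) : ℝ) : ℂ) * (v₂ / ((‖v₂‖ : ℝ) : ℂ)) * e₂ (fm₂ (p 0) (p 1)))
    (hWdef : W = {p : EuclideanSpace ℝ (Fin 4) | |p 0| < 101 / 100 ∧ |p 1| < 101 / 100 ∧ (p 2) ^ 2 + (p 3) ^ 2 < 6 / 5}) :
    ∀ p ∈ W, ∀ q ∈ W, h p ≠ h₂ q := by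
  intro p hp q hq hpq
  obtain ⟨-, -, -, -, -, -, -, -, hVpos⟩ := holeDir_props j hv
  obtain ⟨-, -, -, -, -, -, -, -, hVpos₂⟩ := holeDir_props j' hv₂
  obtain ⟨r', m, σ, ρ, μ, -, -, -, hσpos, -, -, -, -, -, -, hρ, hρpos, -, hμ, -, hm, e1, -⟩ :=
    chart_point hv hReven hRout hRbend hRbounds hRmono hS0 hS1 hS01 hb hN he hfr hfm hz hWdef hp
  obtain ⟨r'₂, m₂, σ₂, ρ₂, μ₂, -, -, -, hσpos₂, -, -, -, -, -, -, hρ₂, hρpos₂, -, hμ₂, -, hm₂, e1₂, -⟩ :=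
    chart_point hv₂ hReven₂ hRout₂ hRbend₂ hRbounds₂ hRmono₂ hS0₂ hS1₂ hS01₂ hb hN he₂ hfr₂ hfm₂ hz₂ hWdef hq
  have hc : holeCentre k j = Complex.mk 0 (-(20 * (k : ℝ))) + v := by rw [hv, add_sub_cancel]
  have hc₂ : holeCentre k j' = Complex.mk 0 (-(20 * (k : ℝ))) + v₂ := by rw [hv₂, add_sub_cancel]
  have hμρ : (μ : ℂ) = (ρ : ℂ) * ((m / ‖v‖ : ℝ) : ℂ) := by
    rw [hμ, hρ]; push_cast; field_simp
  have hμρ₂ : (μ₂ : ℂ) = (ρ₂ : ℂ) * ((m₂ / ‖v₂‖ : ℝ) : ℂ) := by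
    rw [hμ₂, hρ₂]; push_cast; field_simp
  apply tubePoints_ne hjj hv hv₂ hρpos hρpos₂ hm hm₂
  have key : zC (h p) - Complex.mk 0 (-(20 * (k : ℝ))) = zC (h₂ q) - Complex.mk 0 (-(20 * (k : ℝ))) := by rw [hpq]
  have l1 : zC (h p) - Complex.mk 0 (-(20 * (k : ℝ))) = (ρ : ℂ) * v * (1 + ((m / ‖v‖ : ℝ) : ℂ) * Complex.I) := by
    have := e1; rw [hc] at this; rw [hμρ] at this; push_cast at this ⊢; linear_combination this
  have l2 : zC (h₂ q) - Complex.mk 0 (-(20 * (k : ℝ))) = (ρ₂ : ℂ) * v₂ * (1 + ((m₂ / ‖v₂‖ : ℝ) : ℂ) * Complex.I) := by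
    have := e1₂; rw [hc₂] at this; rw [hμρ₂] at this; push_cast at this ⊢; linear_combination this
  rw [← l1, ← l2]; exact key

end ModelHandles

/-- **Registered piece `helper_handlebodyChart_modelHandles_chartStatic` of the data stub, part 1 (the static clauses
of one chart)**: `ModelHandles.chart_static`, fully quantified. [folklore] -/
theorem helper_handlebodyChart_modelHandles_chartStatic : ∀ (k : ℕ) (j : Fin k) (R S b : ℝ → ℝ) (fr fm : ℝ → ℝ → ℝ) (v : ℂ) (N : ℝ) (e : ℝ → ℂ) (h : EuclideanSpace ℝ (Fin 4) → EuclideanSpace ℝ (Fin 4)) (W : Set (EuclideanSpace ℝ (Fin 4))), v = Literature.Topology.FourManifolds.MMSW.holeCentre k j - Complex.mk 0 (-(20 * (k : ℝ))) → ContDiff ℝ ((⊤ : ℕ∞) : WithTop ℕ∞) R → ContDiff ℝ ((⊤ : ℕ∞) : WithTop ℕ∞) S → (∀ t, R (-t) = R t) → (∀ t, S (-t) = 1 - S t) → (∀ t, 1 / 2 ≤ |t| → R t = 2 / 15 * (2 - |t|)) → (∀ t, |t| ≤ 1 / 5 → ‖v‖ - 1 / 250 ≤ R t ∧ R t ≤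 ‖v‖) → (∀ t, -2 ≤ t → t ≤ 0 → 2 / 15 * (2 + t) ≤ R t ∧ R t ≤ ‖v‖) → StrictMonoOn R (Set.Icc (-2) 0) → (∀ t, t ≤ -1 / 5 → S t = 0) → (∀ t, 1 / 5 ≤ t → S t = 1) → StrictMonoOn S (Set.Icc (-1 / 5) (1 / 5)) → (∀ t, 0 ≤ S t ∧ S t ≤ 1) → (∀ t b, -2 < t → t < 2 → 0 < b → ∃ R' S' : ℝ, HasDerivAt R R' t ∧ HasDerivAt S S' t ∧ 0 < R' * Real.cos (Real.pi * S t) + b * Real.pi * S') → (b = fun p => (793 + 95 * p) / 500) → N = 110 * ((k : ℝ) + 1) → (∀ m, e m = (((‖v‖ : ℝ) : ℂ) + (m : ℂ) * Complex.I) * (((Real.sqrt (‖v‖ ^ 2 + m ^ 2))⁻¹ : ℝ) : ℂ)) → (fr = fun t p => R t + b p * Real.sin (Real.pi * S t)) → (fm = fun t p => -(b p) * Real.cos (Real.pi * S t)) → (∀ p, Literature.AlgebraicTopology.Homotopy.HopfFibration.zC (h p) = Complex.mk 0 (-(20 * (k : ℝ))) + ((fr (p 0) (p 1) * Real.sqrt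 (1 - ((p 2) ^ 2 + (p 3) ^ 2) / N ^ 2) : ℝ) : ℂ) * (v / ((‖v‖ : ℝ) : ℂ)) * e (fm (p 0) (p 1))) → (∀ p, Literature.AlgebraicTopology.Homotopy.HopfFibration.wC (h p) = ((fr (p 0) (p 1) / N : ℝ) : ℂ) * ((p 2 : ℂ) + (p 3 : ℂ) * Complex.I)) → W = {p : EuclideanSpace ℝ (Fin 4) | |p 0| < 101 / 100 ∧ |p 1| < 101 / 100 ∧ (p 2) ^ 2 + (p 3) ^ 2 < 6 / 5} → ContDiffOn ℝ ((⊤ : ℕ∞) : WithTop ℕ∞) h W ∧ Set.InjOn h W ∧ (∀ p ∈ W, Function.Injective (fderiv ℝ h p)) ∧ (∀ p ∈ W, dist (h p) (Literature.AlgebraicTopology.Homotopy.HopfFibration.ofZW (Complex.mk 0 (-(20 * (k : ℝ)))) 0) = fr (p 0) (p 1)) ∧ (∀ p ∈ W, 1 / 2 ≤ |p 0| → dist (h p) (Literature.AlgebraicTopology.Homotopy.HopfFibration.ofZW (Complex.mk 0 (-(20 * (k : ℝ)))) 0) = 2 / 15 * (2 - |p 0|)) ∧ (∀ p ∈ W,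 |p 0| ≤ 1 / 2 → 3 * (2 / 15) / 2 ≤ dist (h p) (Literature.AlgebraicTopology.Homotopy.HopfFibration.ofZW (Complex.mk 0 (-(20 * (k : ℝ)))) 0)) ∧ (∀ (β : ℝ) p, h (!₂[p 0, p 1, Real.cos β * p 2 - Real.sin β * p 3, Real.sin β * p 2 + Real.cos β * p 3]) = Literature.Topology.FourManifolds.MMSW.fibreRot (fun _ => Complex.exp ((β : ℂ) * Complex.I)) (h p)) :=
  fun _ _ _ _ _ _ _ _ _ _ _ _ hv hRs hSs hReven hSsymm hRout hRbend hRbounds hRmono hS0 hS1 hSmono hS01 hjac hb hN he hfr hfm hz hw hW =>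
    ModelHandles.chart_static hv hRs hSs hReven hSsymm hRout hRbend hRbounds hRmono hS0 hS1 hSmono hS01 hjac hb hN he hfr hfm hz hw hW

end Summit.SmoothPoincare4.SmoothPoincare4.Theorems.DcrGap.MkFriends

end
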